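import Summits.AtomisticToContinuum.FouriersLaw.Theorems.PositiveMemory.Negative.ExistenceBarrier

/-!
# `PositiveMemory` (crux stmt-AtomisticToContinuum-12694, route `HonestZwanzig`):
# what the fixed-`N` non-degeneracy hypothesis `det G₀ ≠ 0` of `Negative.ExistenceBarrier` means
# (negative-side support, crux-disprover seat gen 3; from `Cruxes/PositiveMemory/Disproof.lean` §6(b))

`Negative.ExistenceBarrier` (p126176) shows that, whenever `det G₀ ≠ 0` for `G₀ = [∫₀^∞corr(e_x,e_y)]` (time-integrated
equilibrium correlations of the split site energies at fixed `N`), every orthogonal DC response `ρ_b = lim_{s↓0} schur_s(j_b,J)`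
of the crux EXISTS and equals an explicit finite-`N` Schur complement, and that under this non-degeneracy the crux is
equivalent to an existence-free floor. This file says what the hypothesis is:

* `G₀_eq_lap_zero`, `G₀_symm` — `G₀ = G(0)` is symmetric (time reversal; the `e_x` are even in the momenta);
* `G₀_form_nonneg` — `G₀` is positive SEMI-definite (`ξᵀG₀ξ = lim_{s↓0} ξᵀG(s)ξ`, `G(s)` positive definite for `s > 0` by
  `FeshbachIdentities` (iv));
* `mulVec_eq_zero_of_form_eq_zero` — for a symmetric positive semidefinite real matrix a vanishing form forces `G₀ξ = 0`
  (first variation);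
* `det_ne_zero_iff_form_pos` — hence `det G₀ ≠ 0 ↔ ξᵀG₀ξ > 0` for every `ξ ≠ 0`;
* `det_G₀_ne_zero_iff` — the canonical instance (`FeshbachIdentities` discharged by the landed `stub_feshbachIdentities`):
  for `pinnedChain` (all parameters `> 0`), `T > 0`, `N ≥ 2`, `G₀` is symmetric positive semidefinite and `det G₀ ≠ 0` iff EVERY
  nonzero energy profile `h = Σ_x ξ_x e_x` has strictly positive time-integrated autocorrelation `∫₀^∞corr(h,h) = ξᵀG₀ξ > 0`.

So the planner's "FixedNLap" is exactly the hypoelliptic non-degeneracy "no energy profile has vanishing integrated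
autocorrelation" (`ξᵀG₀ξ = γT·Σ_{b∈∂}‖∂_{p_b}(−L^*)⁻¹h̄‖²`; a three-commutator argument at the baths is sketched in the work
file §6(b)). This file does NOT refute the crux and introduces no definition.
-/

noncomputable section

open MeasureTheory Finset Real Set Filter Topology
open Literature.MathematicalPhysics.KineticTheory.HeatConduction
open Summit.AtomisticToContinuum.FouriersLaw.Theorems.HonestZwanzig.NetworkReduction
open Summit.AtomisticToContinuum.FouriersLaw.Theorems.PositiveMemory.Negative.ExistenceBarrier

namespace Summit.AtomisticToContinuum.FouriersLaw.Theorems.PositiveMemory.Negative.NonDegeneracy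

/-! ## `G₀` is symmetric positive semidefinite; `det G₀ ≠ 0 ↔ G₀` positive definite -/

section Meaning

variable {ω₂ lam β γ : ℝ} {N : ℕ} {T : ℝ}
  {Adm : (PhaseSpace N → ℝ) → Prop}
  {corr : (PhaseSpace N → ℝ) → (PhaseSpace N → ℝ) → ℝ → ℝ}
  {lap : ℝ → (PhaseSpace N → ℝ) → (PhaseSpace N → ℝ) → ℝ}
  {cov : (PhaseSpace N → ℝ) → (PhaseSpace N → ℝ) → ℝ}
  {e : Fin N → PhaseSpace N → ℝ}
  {G : ℝ → Matrix (Fin N) (Fin N) ℝ}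
  (hAdm : ∀ f, Adm f ↔ (Continuous f ∧ ∃ A : ℝ, ∀ z,
    |f z| ≤ A * Real.exp ((pinnedChain ω₂ lam β γ).hamiltonian N z / (8 * T))))
  (hlap : ∀ s f g, lap s f g = ∫ t in Set.Ioi (0 : ℝ), Real.exp (-(s * t)) * corr f g t)
  (he : ∀ x z, e x z = z.2 x ^ 2 / 2 + (pinnedChain ω₂ lam β γ).U (z.1 x) +
    ∑ j : Fin N, ((if j.val = x.val + 1 then (pinnedChain ω₂ lam β γ).V (z.1 j - z.1 x) / 2 else 0) +
      (if x.val = j.val + 1 then (pinnedChain ω₂ lam β γ).V (z.1 x - z.1 j) / 2 else 0)))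
  (hG : ∀ s x y, G s x y = lap s (e x) (e y))
  (hFI : ∀ f g : PhaseSpace N → ℝ, Adm f → Adm g →
    Integrable f ((pinnedChain ω₂ lam β γ).gibbsMeasure N T) ∧
    (∀ t : ℝ, 0 ≤ t → Integrable (fun z => f z *
      (∫ y, g y ∂((pinnedChain ω₂ lam β γ).transitionKernel N T T t.toNNReal z)))
      ((pinnedChain ω₂ lam β γ).gibbsMeasure N T)) ∧
    IntegrableOn (corr f g) (Set.Ioi 0) ∧
    (∀ t : ℝ, 0 ≤ t → corr f g t = corr (fun z => g (z.1, -z.2)) (fun z => f (z.1, -z.2)) t) ∧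
    (∀ s : ℝ, 0 < s → ∀ x : Fin N,
      s * lap s (e x) g - cov (e x) g =
        lap s (fun z => (pinnedChain ω₂ lam β γ).generator N T T (e x) (z.1, -z.2)) g ∧
      s * lap s f (e x) - cov f (e x) = lap s f ((pinnedChain ω₂ lam β γ).generator N T T (e x))))
  (hGp : ∀ s : ℝ, 0 < s → ∀ v : Fin N → ℝ, v ≠ 0 → 0 < ∑ x, ∑ y, v x * G s x y * v y)
  (hω : 0 < ω₂) (hl : 0 ≤ lam) (hβ : 0 ≤ β) (hT : 0 < T)
  (G₀ : Matrix (Fin N) (Fin N) ℝ) (hG₀ : ∀ x y, G₀ x y = ∫ t in Set.Ioi (0 : ℝ), corr (e x) (e y) t)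

include hlap hG₀ in
/-- `G₀ = G(0)`: at `s = 0` the Laplace weight is `1`. [folklore] -/
theorem G₀_eq_lap_zero (x y : Fin N) : G₀ x y = lap 0 (e x) (e y) := by
  rw [hG₀, hlap]
  refine integral_congr_ae (Eventually.of_forall fun t => ?_)
  simp

include hAdm hlap he hFI hω hl hβ hT hG₀ in
/-- **`G₀` is symmetric** (time reversal; the split site energies are even in the momenta). [folklore] -/
theorem G₀_symm (x y : Fin N) : G₀ x y = G₀ y x := by
  rw [G₀_eq_lap_zero hlap G₀ hG₀, G₀_eq_lap_zero hlap G₀ hG₀]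
  exact pkg_G_symm hAdm hlap he hFI hω hl hβ hT 0 x y

include hAdm hlap he hG hFI hGp hω hl hβ hT hG₀ in
/-- **`G₀` is positive semidefinite**: `ξᵀG₀ξ = lim_{s↓0} ξᵀG(s)ξ ≥ 0` (`G(s)` positive definite for `s > 0`,
`FeshbachIdentities` (iv)). [folklore] -/
theorem G₀_form_nonneg (ξ : Fin N → ℝ) : 0 ≤ ∑ x, ∑ y, ξ x * G₀ x y * ξ y := by
  have hL1 : ∀ f g : PhaseSpace N → ℝ, Adm f → Adm g → IntegrableOn (corr f g) (Set.Ioi 0) :=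
    fun f g hf hg => (hFI f g hf hg).2.2.1
  have ht : Tendsto (fun s => ∑ x, ∑ y, ξ x * G s x y * ξ y) (nhdsWithin (0 : ℝ) (Set.Ioi 0))
      (nhds (∑ x, ∑ y, ξ x * G₀ x y * ξ y)) := by
    refine tendsto_finsetSum _ fun x _ => tendsto_finsetSum _ fun y _ => ?_
    rw [hG₀ x y]
    exact (tendsto_const_nhds.mul (tendsto_G_apply hAdm hlap he hG hL1 hω hl hβ hT x y)).mul
      tendsto_const_nhds
  refine ge_of_tendsto ht ?_
  filter_upwards [self_mem_nhdsWithin] with s hs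
  by_cases hξ : ξ = 0
  · simp [hξ]
  · exact (hGp s hs ξ hξ).le

omit hG₀ in
/-- Linear algebra: a SYMMETRIC positive semidefinite real form that vanishes at `ξ` has `G₀ξ = 0`
(first variation of `η ↦ (ξ+tη)ᵀG₀(ξ+tη) ≥ 0` at `t = 0`). [folklore] -/
theorem mulVec_eq_zero_of_form_eq_zero (hsymm : ∀ x y, G₀ x y = G₀ y x)
    (hpsd : ∀ η : Fin N → ℝ, 0 ≤ ∑ x, ∑ y, η x * G₀ x y * η y)
    (ξ : Fin N → ℝ) (h0 : ∑ x, ∑ y, ξ x * G₀ x y * ξ y = 0) : G₀.mulVec ξ = 0 := by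
  -- bilinear bookkeeping
  set B : (Fin N → ℝ) → (Fin N → ℝ) → ℝ := fun u v => ∑ x, ∑ y, u x * G₀ x y * v y with hB
  have hBsymm : ∀ u v, B u v = B v u := by
    intro u v
    simp only [hB]
    rw [Finset.sum_comm]
    refine Finset.sum_congr rfl fun y _ => Finset.sum_congr rfl fun x _ => ?_
    rw [hsymm x y]; ring
  have hexp : ∀ (u v : Fin N → ℝ) (t : ℝ),
      B (fun x => u x + t * v x) (fun x => u x + t * v x) = B u u + 2 * t * B u v + t ^ 2 * B v v := by
    intro u v t
    have h1 : B (fun x => u x + t * v x) (fun x => u x + t * v x) =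
        B u u + t * B u v + t * B v u + t ^ 2 * B v v := by
      simp only [hB, Finset.mul_sum, ← Finset.sum_add_distrib]
      refine Finset.sum_congr rfl fun x _ => Finset.sum_congr rfl fun y _ => ?_
      ring
    rw [h1, hBsymm v u]; ring
  -- first variation: B ξ η = 0 for every η
  have hvar : ∀ η : Fin N → ℝ, B ξ η = 0 := by
    intro η
    by_contra hne
    set b := B ξ η with hb
    set F := B η η with hF
    have hF0 : 0 ≤ F := hpsd η
    have hξ0 : B ξ ξ = 0 := h0
    -- evaluate at t = -b/(F+1)
    have hpos : 0 < F + 1 := by linarith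
    have key := hpsd (fun x => ξ x + (-b / (F + 1)) * η x)
    have key' : 0 ≤ B ξ ξ + 2 * (-b / (F + 1)) * b + (-b / (F + 1)) ^ 2 * F := by
      have := hexp ξ η (-b / (F + 1))
      rw [← hb, ← hF] at this
      rw [← this]; exact key
    rw [hξ0, zero_add] at key'
    have hb2 : 0 < b ^ 2 := by positivity
    have hcalc : 2 * (-b / (F + 1)) * b + (-b / (F + 1)) ^ 2 * F = -(b ^ 2 / (F + 1)) * ((F + 2) / (F + 1)) := by
      field_simp
      ring
    rw [hcalc] at key'
    have h3 : 0 < b ^ 2 / (F + 1) * ((F + 2) / (F + 1)) := by positivity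
    linarith
  -- read off the components with η = indicator vectors
  funext x
  have hx := hvar (fun y => if y = x then 1 else 0)
  simp only [hB, mul_ite, mul_one, mul_zero, Finset.sum_ite_eq', Finset.mem_univ, if_true] at hx
  rw [Matrix.mulVec_apply_eq_sum, Pi.zero_apply, ← hx]
  refine Finset.sum_congr rfl fun y _ => ?_
  rw [hsymm x y]; ring

omit hG₀ in
/-- **`det G₀ ≠ 0` iff the form is positive definite**, for a symmetric positive semidefinite `G₀` — so the non-degeneracy
hypothesis of §2–§3 says exactly: no nonzero energy profile `h = Σ_x ξ_x e_x` has vanishing time-integrated autocorrelation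
`∫₀^∞corr(h,h) = ξᵀG₀ξ`. [folklore] -/
theorem det_ne_zero_iff_form_pos (hsymm : ∀ x y, G₀ x y = G₀ y x)
    (hpsd : ∀ η : Fin N → ℝ, 0 ≤ ∑ x, ∑ y, η x * G₀ x y * η y) :
    G₀.det ≠ 0 ↔ ∀ ξ : Fin N → ℝ, ξ ≠ 0 → 0 < ∑ x, ∑ y, ξ x * G₀ x y * ξ y := by
  have hform : ∀ ξ : Fin N → ℝ, ∑ x, ∑ y, ξ x * G₀ x y * ξ y = ∑ x, ξ x * (G₀.mulVec ξ) x := by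
    intro ξ
    refine Finset.sum_congr rfl fun x _ => ?_
    rw [Matrix.mulVec_apply_eq_sum, Finset.mul_sum]
    refine Finset.sum_congr rfl fun y _ => ?_
    ring
  constructor
  · intro hdet ξ hξ
    rcases (hpsd ξ).lt_or_eq with hlt | heq
    · exact hlt
    · exfalso
      have hker := mulVec_eq_zero_of_form_eq_zero G₀ hsymm hpsd ξ heq.symm
      exact hdet (Matrix.exists_mulVec_eq_zero_iff.1 ⟨ξ, hξ, hker⟩)
  · intro hpos hdet
    obtain ⟨v, hv, hGv⟩ := Matrix.exists_mulVec_eq_zero_iff.2 hdet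
    have h := hpos v hv
    rw [hform v, hGv] at h
    simp at h

end Meaning

/-- **The non-degeneracy hypothesis in physical form (canonical gadgets).** For `pinnedChain ω₂ lam β γ` (all `> 0`),
`T > 0`, `N ≥ 2`: `G₀ = [∫₀^∞corr(e_x,e_y)]` is symmetric positive semidefinite, and `det G₀ ≠ 0` iff EVERY nonzero energy
profile `h = Σ_x ξ_x e_x` has strictly positive time-integrated autocorrelation `ξᵀG₀ξ = ∫₀^∞corr(h,h) > 0` — the honest
content of the planner's "FixedNLap" (expected: a hypoelliptic non-degeneracy at the baths, see the work file §6(b)). [folklore] -/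
theorem det_G₀_ne_zero_iff (ω₂ lam β γ : ℝ) (hω : 0 < ω₂) (hl : 0 < lam) (hβ : 0 < β) (hγ : 0 < γ)
    (T : ℝ) (hT : 0 < T) (N : ℕ) (hN : 2 ≤ N) :
    let P := Literature.MathematicalPhysics.KineticTheory.HeatConduction.pinnedChain ω₂ lam β γ
    let X := Literature.MathematicalPhysics.KineticTheory.HeatConduction.PhaseSpace N
    let μ : MeasureTheory.Measure X := P.gibbsMeasure N T
    let corr : (X → ℝ) → (X → ℝ) → ℝ → ℝ := fun f g t =>
      (∫ z, f z * (∫ y, g y ∂(P.transitionKernel N T T t.toNNReal z)) ∂μ) - (∫ z, f z ∂μ) * (∫ z, g z ∂μ)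
    let e : Fin N → X → ℝ := fun x z => z.2 x ^ 2 / 2 + P.U (z.1 x) +
      ∑ j : Fin N, ((if j.val = x.val + 1 then P.V (z.1 j - z.1 x) / 2 else 0) +
        (if x.val = j.val + 1 then P.V (z.1 x - z.1 j) / 2 else 0))
    let G₀ : Matrix (Fin N) (Fin N) ℝ := Matrix.of fun x y => ∫ t in Set.Ioi (0 : ℝ), corr (e x) (e y) t
    (∀ x y, G₀ x y = G₀ y x) ∧ (∀ ξ : Fin N → ℝ, 0 ≤ ∑ x, ∑ y, ξ x * G₀ x y * ξ y) ∧
      (G₀.det ≠ 0 ↔ ∀ ξ : Fin N → ℝ, ξ ≠ 0 → 0 < ∑ x, ∑ y, ξ x * G₀ x y * ξ y) := by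
  intro P X μ corr e G₀
  obtain ⟨-, hFI2, -, hGp⟩ :=
    Summit.AtomisticToContinuum.FouriersLaw.Theorems.HonestZwanzig.stub_feshbachIdentities
      ω₂ lam β γ hω hl hβ hγ T hT N hN
  have hsymm : ∀ x y, G₀ x y = G₀ y x :=
    G₀_symm (ω₂ := ω₂) (lam := lam) (β := β) (γ := γ) (N := N) (T := T)
      (Adm := fun f => Continuous f ∧ ∃ A : ℝ, ∀ z,
        |f z| ≤ A * Real.exp ((pinnedChain ω₂ lam β γ).hamiltonian N z / (8 * T)))
      (corr := corr) (lap := fun s f g => ∫ t in Set.Ioi (0 : ℝ), Real.exp (-(s * t)) * corr f g t)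
      (cov := fun f g => (∫ z, f z * g z ∂μ) - (∫ z, f z ∂μ) * (∫ z, g z ∂μ)) (e := e)
      (fun f => Iff.rfl) (fun s f g => rfl) (fun x z => rfl) hFI2 hω hl.le hβ.le hT G₀ (fun x y => rfl)
  have hpsd : ∀ ξ : Fin N → ℝ, 0 ≤ ∑ x, ∑ y, ξ x * G₀ x y * ξ y :=
    G₀_form_nonneg (ω₂ := ω₂) (lam := lam) (β := β) (γ := γ) (N := N) (T := T)
      (Adm := fun f => Continuous f ∧ ∃ A : ℝ, ∀ z,
        |f z| ≤ A * Real.exp ((pinnedChain ω₂ lam β γ).hamiltonian N z / (8 * T)))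
      (corr := corr) (lap := fun s f g => ∫ t in Set.Ioi (0 : ℝ), Real.exp (-(s * t)) * corr f g t)
      (cov := fun f g => (∫ z, f z * g z ∂μ) - (∫ z, f z ∂μ) * (∫ z, g z ∂μ)) (e := e)
      (G := fun s => Matrix.of fun x y => ∫ t in Set.Ioi (0 : ℝ), Real.exp (-(s * t)) * corr (e x) (e y) t)
      (fun f => Iff.rfl) (fun s f g => rfl) (fun x z => rfl) (fun s x y => rfl) hFI2 hGp hω hl.le hβ.le hT G₀
      (fun x y => rfl)
  exact ⟨hsymm, hpsd, det_ne_zero_iff_form_pos G₀ hsymm hpsd⟩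

end Summit.AtomisticToContinuum.FouriersLaw.Theorems.PositiveMemory.Negative.NonDegeneracy

end
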